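import Summits.AtomisticToContinuum.FouriersLaw.Theorems.OddSectorIrreversibilityTapLeakBoundLocalMomentQ

/-!
# `TapLeakBound` (stmt-AtomisticToContinuum-15159), line `SketchIdeator2`: MixedTapBound from the position tap budget

Helper file (`--supports stmt-AtomisticToContinuum-15159`) for crux P =
`Summit.AtomisticToContinuum.FouriersLaw.Theses.OddSectorIrreversibility.TapLeakBound` (route
`OddSectorIrreversibility`, sub-problem `FouriersLaw`). By-product of the stub-worker on the registered stub D
`stub_hessianDrive` (the `N`-uniform Hessian-drive budget `‖G_b‖² ≤ C(|⟨u,J⟩| + Z)`, `G_b = Σ_i (∂_{q_b}∂_{q_i}H) ∂_{p_i}u`),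
which is NOT proved here. Proved instead (part 1 of 2; part 2 = `…TapLeakBoundPositionTapOfHessianDrive.lean`):

**`MixedTapBound` (the skeleton's `stub_mixedTap_of`, the ONLY consumer of stubs M `stub_partialQMem` and D) follows from
the `N`-uniform POSITION TAP BUDGET `∂_{q_b}u ∈ L²(μ_T)` ∧ `‖∂_{q_b}u‖² ≤ C_q(|⟨u,J⟩| + Z)` alone** — Cauchy–Schwarz and the
landed tap energy identity `γB_bT‖∂_{p_b}u‖² ≤ ⟨u,J⟩` (`integral_mul_source_eq_dirichlet`):
`T⟨∂_{q_b}u, ∂_{p_b}u⟩ ≤ ⟨u,J⟩/(2γ) + (T/2)‖∂_{q_b}u‖²` (`mixedTap_of_positionTap_core`), hence `MixedTapBound` with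
`C = 1/(2γ) + (T/2)C_q⁺` (`mixedTapBound_of_positionTapBudget`) — no Hessian drive, no resolvent. Part 2 shows conversely
(M ∧ D) ⇒ position tap budget over the landed overdamped calculus, so the corrector side of the line needs exactly ONE
`N`-uniform first-order statement (M is its fixed-`N` membership half); D (second order: `G_b = L(∂_{q_b}u) + ∂_{q_b}J`) is
sufficient, not necessary. References: folklore. Nothing here closes the item.
-/

noncomputable section

open MeasureTheory ProbabilityTheory Filter Topology Set Function
open scoped NNReal ENNReal ContDiff

namespace Summit.AtomisticToContinuum.FouriersLaw.Theorems.OddSectorIrreversibility.TapLeak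

open Literature.MathematicalPhysics.KineticTheory.HeatConduction
open Literature.MathematicalPhysics.KineticTheory
open Summit.AtomisticToContinuum.FouriersLaw.Theorems.OddSectorWitness
open Summit.AtomisticToContinuum.FouriersLaw.Theorems.OddSectorIrreversibility.Corrector
open Summit.AtomisticToContinuum.FouriersLaw.Theorems.SuperadditiveResistance.DeviceLiouville

/-! ### Fixed-`N` core -/

section Core

variable {ω₂ lam β γ : ℝ} (hω : 0 < ω₂) (hl : 0 ≤ lam) (hβ : 0 ≤ β) (hγ : 0 < γ) {T : ℝ} (hT : 0 < T)
  {N : ℕ}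

include hω hl hβ hγ hT

/-- **Mixed tap pairing from the position tap norm, at fixed `N`.** For a smooth classical solution `u` of
`L_{T,T} u = −J` at a contact `b` with `u, ∂_{q_b}u ∈ L²(μ_T)`:
`T⟨∂_{q_b}u, ∂_{p_b}u⟩ ≤ ⟨u,J⟩/(2γ) + (T/2)‖∂_{q_b}u‖²` (`2ab ≤ a² + b²` and the tap energy identity
`γB_bT‖∂_{p_b}u‖² ≤ ⟨u,J⟩`, `B_b ≥ 1`). [folklore] -/
theorem mixedTap_of_positionTap_core (b : Fin N) (hb : b.val = 0 ∨ b.val = N - 1) {u : PhaseSpace N → ℝ}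
    (hu : ContDiff ℝ ∞ u)
    (hpde : ∀ x, (pinnedChain ω₂ lam β γ).generator N T T u x =
      -(∑ k : Fin N, (pinnedChain ω₂ lam β γ).bondCurrent N k x))
    (hu2 : MemLp u 2 (gibbsWeight ω₂ lam β γ N T))
    (hqu2 : MemLp (partialQ b u) 2 (gibbsWeight ω₂ lam β γ N T)) :
    T * ∫ x, partialQ b u x * partialP b u x ∂(gibbsWeight ω₂ lam β γ N T) ≤
      1 / (2 * γ) * ∫ x, u x * (∑ k : Fin N, (pinnedChain ω₂ lam β γ).bondCurrent N k x) ∂(gibbsWeight ω₂ lam β γ N T) +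
        T / 2 * ∫ x, (partialQ b u x) ^ 2 ∂(gibbsWeight ω₂ lam β γ N T) := by
  -- adapted from `mixedTap_core` (…TapLeakBoundMixedTap)
  set P := pinnedChain ω₂ lam β γ with hP
  set μ := gibbsWeight ω₂ lam β γ N T with hμ
  set B : ℝ := OscillatorChain.bathWeight N b with hB
  set J : PhaseSpace N → ℝ := fun z => ∑ k : Fin N, P.bondCurrent N k z with hJ
  set v : PhaseSpace N → ℝ := partialP b u with hv
  set w : PhaseSpace N → ℝ := partialQ b u with hw
  haveI : IsFiniteMeasure μ := isFiniteMeasure_gibbsWeight hω hl hβ γ N hT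
  -- the contact carries a bath: `B ≥ 1`, `κ = γ B ≥ γ`
  have hB1 : 1 ≤ B := by
    simp only [hB]
    unfold OscillatorChain.bathWeight
    rcases hb with h | h
    · rw [if_pos h]; split_ifs <;> norm_num
    · rw [if_pos h]; split_ifs <;> norm_num
  have hB0 : 0 < B := lt_of_lt_of_le one_pos hB1
  set κ : ℝ := γ * B with hκ
  have hκ0 : 0 < κ := mul_pos hγ hB0
  have hγκ : γ ≤ κ := le_mul_of_one_le_right hγ.le hB1
  -- smoothness and `L²` bookkeeping
  have hu2c : ContDiff ℝ 2 u := hu.of_le (by norm_cast)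
  have hJc : Continuous J := continuous_totalBondCurrent ω₂ lam β γ N
  have hϑ : 0 < 1 / (4 * T) := by positivity
  have h2ϑ : 2 * (1 / (4 * T)) < 1 / T := by
    rw [show 2 * (1 / (4 * T)) = 1 / (2 * T) by field_simp; ring, div_lt_div_iff₀ (by positivity) hT]
    nlinarith
  obtain ⟨M, -, hJM⟩ := abs_totalBondCurrent_le_exp hω.le hl hβ γ N hϑ
  have hJ2π : MemLp J 2 (P.gibbsMeasure N T) := memLp_two_of_abs_le_exp hω hl hβ hT γ hJc h2ϑ hJM
  have hu2π : MemLp u 2 (P.gibbsMeasure N T) := memLp_gibbsMeasure_of_gibbsWeight hω hl hβ γ N hT hu2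
  have hv2π : MemLp v 2 (P.gibbsMeasure N T) := memLp_partialP_of_poisson hω hl hβ hγ hT hu2c hu2π hJ2π hpde hB0
  have hv2 : MemLp v 2 μ := memLp_gibbsWeight_of_gibbsMeasure hω hl hβ γ N hT hv2π
  -- the tap identity: `κ T ‖v‖² ≤ ⟨u, J⟩`
  have hρ : ∀ f : PhaseSpace N → ℝ, ∫ x, f x ∂μ = ∫ x, f x * P.gibbsDensity N T x := fun f =>
    gaussIBP_integral_gibbsWeight ω₂ lam β γ N T f
  have hD0 := integral_mul_source_eq_dirichlet hω hl hβ hγ hT hu2c hu2π hJc hJ2π hpde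
  have hD0' : ∫ x, u x * J x ∂μ = γ * T * ∑ i, OscillatorChain.bathWeight N i * ∫ x, partialP i u x ^ 2 ∂μ := by
    rw [hρ]
    simp only [hρ]
    exact hD0
  have hIn : ∀ i, 0 ≤ ∫ x, partialP i u x ^ 2 ∂μ := fun i => integral_nonneg fun x => sq_nonneg _
  have hle : B * ∫ x, (v x) ^ 2 ∂μ ≤ ∑ i, OscillatorChain.bathWeight N i * ∫ x, partialP i u x ^ 2 ∂μ :=
    Finset.single_le_sum (f := fun i => OscillatorChain.bathWeight N i * ∫ x, partialP i u x ^ 2 ∂μ)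
      (fun i _ => mul_nonneg (Corrector.bathWeight_nonneg N i) (hIn i)) (Finset.mem_univ b)
  have htap : κ * T * ∫ x, (v x) ^ 2 ∂μ ≤ ∫ x, u x * J x ∂μ := by
    rw [hD0']
    have := mul_le_mul_of_nonneg_left hle (mul_nonneg hγ.le hT.le)
    calc κ * T * ∫ x, (v x) ^ 2 ∂μ = γ * T * (B * ∫ x, (v x) ^ 2 ∂μ) := by simp only [hκ]; ring
      _ ≤ _ := this
  -- `2 w v ≤ w² + v²`
  have hIvv : Integrable (fun x => (v x) ^ 2) μ := hv2.integrable_sq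
  have hIww : Integrable (fun x => (w x) ^ 2) μ := hqu2.integrable_sq
  have hIwv : Integrable (fun x => w x * v x) μ := hqu2.integrable_mul hv2
  have hwv : ∫ x, w x * v x ∂μ ≤ ((∫ x, (w x) ^ 2 ∂μ) + ∫ x, (v x) ^ 2 ∂μ) / 2 := by
    have hIs : Integrable (fun x => ((w x) ^ 2 + (v x) ^ 2) / 2) μ := (hIww.add hIvv).div_const 2
    have h : ∫ x, w x * v x ∂μ ≤ ∫ x, ((w x) ^ 2 + (v x) ^ 2) / 2 ∂μ :=
      integral_mono hIwv hIs fun x => by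
        show w x * v x ≤ ((w x) ^ 2 + (v x) ^ 2) / 2
        linarith [sq_nonneg (w x - v x)]
    rw [integral_div, integral_add hIww hIvv] at h
    exact h
  -- arithmetic on real atoms
  have hA0 : 0 ≤ ∫ x, u x * J x ∂μ := by
    have : 0 ≤ κ * T * ∫ x, (v x) ^ 2 ∂μ := mul_nonneg (mul_nonneg hκ0.le hT.le) (integral_nonneg fun x => sq_nonneg _)
    linarith
  generalize hXdef : ∫ x, (v x) ^ 2 ∂μ = X at htap hwv
  generalize hWdef : ∫ x, (w x) ^ 2 ∂μ = W at hwv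
  generalize hAdef : ∫ x, u x * J x ∂μ = A at htap hA0
  generalize hWVdef : ∫ x, w x * v x ∂μ = WV at hwv
  have h1 : T * WV ≤ T / 2 * W + T / 2 * X := by
    have := mul_le_mul_of_nonneg_left hwv hT.le
    linarith
  have h2 : T / 2 * X ≤ A / (2 * κ) := by
    rw [le_div_iff₀ (by positivity)]
    nlinarith
  have h3 : A / (2 * κ) ≤ A / (2 * γ) := div_le_div_of_nonneg_left hA0 (by positivity) (by linarith)
  have e4 : 1 / (2 * γ) * A = A / (2 * γ) := by ring
  linarith

end Core

/-! ### MixedTapBound from the position tap budget -/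

/-- **MixedTapBound (the registered `stub_mixedTap`, verbatim) from the `N`-uniform POSITION TAP BUDGET**
`∂_{q_b}u ∈ L²(μ_T)` ∧ `‖∂_{q_b}u‖² ≤ C_q(|⟨u,J⟩| + Z)`: by `mixedTap_of_positionTap_core` at each `(N, b, u)` (`u` is the
smooth corrector by `stub_correctorSmooth`), with `C = 1/(2γ) + (T/2)C_q⁺`. No Hessian drive and no fixed-`N` input beyond
the budget's own membership conjunct are needed. [folklore] -/
theorem mixedTapBound_of_positionTapBudget
    (hQB : ∀ ω₂ lam β γ : ℝ, 0 < ω₂ → 0 < lam → 0 < β → 0 < γ → ∀ T : ℝ, 0 < T →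
      ∃ C : ℝ, ∀ (N : ℕ) (b : Fin N) (u : PhaseSpace N → ℝ), (b.val = 0 ∨ b.val = N - 1) →
        ContDiff ℝ 1 u → MemLp u 2 (gibbsWeight ω₂ lam β γ N T) →
        (∀ᵐ x ∂(gibbsWeight ω₂ lam β γ N T), Tendsto (fun τ : ℝ => ∫ t in Set.Ioc (0 : ℝ) τ,
            (∫ y, (∑ k : Fin N, (pinnedChain ω₂ lam β γ).bondCurrent N k y)
              ∂((pinnedChain ω₂ lam β γ).transitionKernel N T T t.toNNReal x))) atTop (𝓝 (u x))) →
          MemLp (partialQ b u) 2 (gibbsWeight ω₂ lam β γ N T) ∧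
          ∫ x, (partialQ b u x) ^ 2 ∂(gibbsWeight ω₂ lam β γ N T) ≤
            C * (|∫ x, u x * (∑ k : Fin N, (pinnedChain ω₂ lam β γ).bondCurrent N k x) ∂(gibbsWeight ω₂ lam β γ N T)| +
              ∫ x, Real.exp (-((pinnedChain ω₂ lam β γ).hamiltonian N x) / T) ∂volume)) :
    ∀ ω₂ lam β γ : ℝ, 0 < ω₂ → 0 < lam → 0 < β → 0 < γ → ∀ T : ℝ, 0 < T →
      ∃ C : ℝ, ∀ (N : ℕ) (b : Fin N) (u : PhaseSpace N → ℝ), (b.val = 0 ∨ b.val = N - 1) →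
        ContDiff ℝ 1 u → MemLp u 2 (gibbsWeight ω₂ lam β γ N T) →
        (∀ᵐ x ∂(gibbsWeight ω₂ lam β γ N T), Tendsto (fun τ : ℝ => ∫ t in Set.Ioc (0 : ℝ) τ,
            (∫ y, (∑ k : Fin N, (pinnedChain ω₂ lam β γ).bondCurrent N k y)
              ∂((pinnedChain ω₂ lam β γ).transitionKernel N T T t.toNNReal x))) atTop (𝓝 (u x))) →
          MemLp (partialQ b u) 2 (gibbsWeight ω₂ lam β γ N T) ∧
          T * ∫ x, partialQ b u x * partialP b u x ∂(gibbsWeight ω₂ lam β γ N T) ≤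
            C * (|∫ x, u x * (∑ k : Fin N, (pinnedChain ω₂ lam β γ).bondCurrent N k x) ∂(gibbsWeight ω₂ lam β γ N T)| +
              ∫ x, Real.exp (-((pinnedChain ω₂ lam β γ).hamiltonian N x) / T) ∂volume) := by
  intro ω₂ lam β γ hω hl hβ hγ T hT
  obtain ⟨CQ, hCQ⟩ := hQB ω₂ lam β γ hω hl hβ hγ T hT
  refine ⟨1 / (2 * γ) + T / 2 * max CQ 0, fun N b u hb hu1 hu2 hlim => ?_⟩
  obtain ⟨hu, hpde⟩ := stub_correctorSmooth hω hl hβ hγ hT hu1.continuous hlim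
  obtain ⟨hqu2, hQle⟩ := hCQ N b u hb hu1 hu2 hlim
  refine ⟨hqu2, (mixedTap_of_positionTap_core hω hl.le hβ.le hγ hT b hb hu hpde hu2 hqu2).trans ?_⟩
  -- arithmetic on real atoms
  have hZ0 : 0 ≤ ∫ x, Real.exp (-((pinnedChain ω₂ lam β γ).hamiltonian N x) / T) ∂volume :=
    integral_nonneg fun x => (Real.exp_pos _).le
  generalize hZ : ∫ x, Real.exp (-((pinnedChain ω₂ lam β γ).hamiltonian N x) / T) ∂volume = Z at hZ0 hQle ⊢
  generalize hA : ∫ x, u x * (∑ k : Fin N, (pinnedChain ω₂ lam β γ).bondCurrent N k x) ∂(gibbsWeight ω₂ lam β γ N T) = A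
    at hQle ⊢
  generalize hQQ : ∫ x, (partialQ b u x) ^ 2 ∂(gibbsWeight ω₂ lam β γ N T) = QQ at hQle ⊢
  have hS0 : 0 ≤ |A| + Z := add_nonneg (abs_nonneg A) hZ0
  have h1 : QQ ≤ max CQ 0 * (|A| + Z) := hQle.trans (mul_le_mul_of_nonneg_right (le_max_left _ _) hS0)
  have h2 : T / 2 * QQ ≤ T / 2 * (max CQ 0 * (|A| + Z)) := mul_le_mul_of_nonneg_left h1 (by positivity)
  have h3 : 1 / (2 * γ) * A ≤ 1 / (2 * γ) * (|A| + Z) :=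
    mul_le_mul_of_nonneg_left (by linarith [le_abs_self A]) (by positivity)
  have e4 : (1 / (2 * γ) + T / 2 * max CQ 0) * (|A| + Z) =
      1 / (2 * γ) * (|A| + Z) + T / 2 * (max CQ 0 * (|A| + Z)) := by ring
  linarith

/-- **Registered glue stub `stub_mixedTapOfPositionTap` of line `SketchIdeator2`** (= `mixedTapBound_of_positionTapBudget`
in closed `∀`-form): the `N`-uniform position tap budget implies `MixedTapBound` verbatim. [folklore] -/
theorem stub_mixedTapOfPositionTap : (∀ ω₂ lam β γ : ℝ, 0 < ω₂ → 0 < lam → 0 < β → 0 < γ → ∀ T : ℝ, 0 < T → ∃ C : ℝ, ∀ (N : ℕ) (b : Fin N) (u : PhaseSpace N → ℝ), (b.val = 0 ∨ b.val = N - 1) → ContDiff ℝ 1 u → MemLp u 2 (gibbsWeight ω₂ lam β γ N T) → (∀ᵐ x ∂(gibbsWeight ω₂ lam β γ N T), Tendsto (fun τ : ℝ => ∫ t in Set.Ioc (0 : ℝ) τ, (∫ y, (∑ k : Fin N, (pinnedChain ω₂ lam β γ).bondCurrent N k y) ∂((pinnedChain ω₂ lam β γ).transitionKernel N T T t.toNNReal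 x))) atTop (𝓝 (u x))) → MemLp (partialQ b u) 2 (gibbsWeight ω₂ lam β γ N T) ∧ ∫ x, (partialQ b u x) ^ 2 ∂(gibbsWeight ω₂ lam β γ N T) ≤ C * (|∫ x, u x * (∑ k : Fin N, (pinnedChain ω₂ lam β γ).bondCurrent N k x) ∂(gibbsWeight ω₂ lam β γ N T)| + ∫ x, Real.exp (-((pinnedChain ω₂ lam β γ).hamiltonian N x) / T) ∂volume)) → ∀ ω₂ lam β γ : ℝ, 0 < ω₂ → 0 < lam → 0 < β → 0 < γ → ∀ T : ℝ, 0 < T → ∃ C : ℝ, ∀ (N : ℕ) (b : Fin N) (u : PhaseSpace N → ℝ), (b.val = 0 ∨ b.val = N - 1) → ContDiff ℝ 1 u → MemLp u 2 (gibbsWeight ω₂ lam β γ N T) → (∀ᵐ x ∂(gibbsWeight ω₂ lam β γ N T), Tendsto (fun τ : ℝ => ∫ t in Set.Ioc (0 : ℝ) τ, (∫ y, (∑ k : Fin N, (pinnedChain ω₂ lam β γ).bondCurrent N k y) ∂((pinnedChain ω₂ lam β γ).transitionKernel N T T t.toNNReal x))) atTop (𝓝 (u x))) → MemLp (partialQ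 b u) 2 (gibbsWeight ω₂ lam β γ N T) ∧ T * ∫ x, partialQ b u x * partialP b u x ∂(gibbsWeight ω₂ lam β γ N T) ≤ C * (|∫ x, u x * (∑ k : Fin N, (pinnedChain ω₂ lam β γ).bondCurrent N k x) ∂(gibbsWeight ω₂ lam β γ N T)| + ∫ x, Real.exp (-((pinnedChain ω₂ lam β γ).hamiltonian N x) / T) ∂volume) :=
  mixedTapBound_of_positionTapBudget

end Summit.AtomisticToContinuum.FouriersLaw.Theorems.OddSectorIrreversibility.TapLeak

end
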